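import Literature.Geometry.Lorentzian.CoordScalarCurvatureEvolution
import Literature.Geometry.Lorentzian.CoordCurvature
import Literature.Geometry.Lorentzian.KerrSchild
import HarnessLib

/-!
# Local extension of Killing vector fields across strongly pseudo-convex hypersurfaces in
# Ricci-flat manifolds (Ionescu–Klainerman 2013), chart form with the printed uniformity

A **named fact** (D-0014): A. D. Ionescu, S. Klainerman, *On the local extension of Killing
vector-fields in Ricci flat manifolds*, J. Amer. Math. Soc. 26 (2013) 563–593
(arXiv:1108.3575), **Theorem 1.2** together with the quantitative set-up of §2.2 ((quant2),
**Lemma 2.10**, **Lemma 2.11** and the remark after Theorem 1.2): for a smooth Ricci-flat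
pseudo-Riemannian `(M, g)`, an open `O ⊆ M` strongly pseudo-convex at `p ∈ ∂O` (Def. 1.1: a
defining function `f`, `O ∩ U = {f < 0}`, `∇f(p) ≠ 0`, `D²f(X, X)(p) < 0` for `X ≠ 0` with
`X(f)(p) = 0 = g_p(X, X)`), every smooth Killing field `Z` on `O` extends as a Killing field to a
neighbourhood of `p`; in coordinates `Φᵖ : B₁ → B₁(p)` with `g_{αβ}(p) = diag(−1, 1, 1, 1)` and
`sup_{B₁(p)} Σ_{j=1}^{6} |∂ʲ g| + Σ_{j=1}^{4} |∂ʲ f| ≤ A`, and with the quantitative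
pseudo-convexity (quant6) `|∂¹f(p)| ≥ A₁⁻¹`,
`XᵅXᵝ(μ g_{αβ}(p) − D_αD_βf(p)) + A₁ |X(f)(p)|² ≥ A₁⁻¹ |X|²` for some `μ ∈ [−A₁, A₁]`
(`A₁ ≥ A`), the vanishing of the extension tensors — hence the extension — holds on
`B_{δ₁}(p)` for data given on `B_{δ₀}(p) ∩ O`, where "`δ₁ > 0` depends only on `A`, `δ₀` and
`A₁`" and "does not depend in any way on the vector-field `Z` itself" (pp. 3, 8 of the arXiv
version).

## Rendering (`MetricCoord` calculus of `CoordCurvature.lean` / `CoordScalarCurvatureEvolution.lean`)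

`d = 4`, Lorentzian normalisation at the centre (`G p = Minkowski.bilin`), the metric a
`MetricCoord.IsMetricOn` datum `G` on the unit ball of `E4` with coordinate Ricci form
`MetricCoord.ricAt G = 0` there ("Ricci flat"), the covariant Hessian in coordinates
`MetricCoord.hessAt G f p` (`D_αD_βf`), Mathlib operator norms of `iteratedFDeriv` in place of
the component sums `|∂ʲ·|` (equivalent up to a dimensional constant absorbed in the universally
quantified `A`), the Killing equation in its coordinate form
`DG(Z)(Y, W) + G(DZ Y, W) + G(Y, DZ W) = 0` (equivalent to `g(∇_Y Z, W) + g(Y, ∇_W Z) = 0` for a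
metric datum; cf. `Summits/…/BartnikGapSettlingGapExhaustionKillingCoordBridge.lean`), and `C^∞`
for "smooth" (the printed theorem is for smooth data and delivers a smooth extension). The
conclusion is stated directly as the existence of the extended coordinate field on `B_{δ₁}(p)`
agreeing with `Z` on `B_{δ₁}(p) ∩ {f < 0}` (the printed conclusion of Thm 1.2 after the
quantitative localisation of Lemma 2.10).
-- TODO(general form): all dimensions and signatures; IK's component-sum norms; `Cᵏ` data.

Consumed (as a hypothesis, by δ-unfolding) by the crux line `photon-shell-pseudoconvexity` of
`GapExhaustion` (route `BartnikGapSettling`): `Summits/…/BartnikGapSettlingGapExhaustionIKLocalStep.lean`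
(`stub_ikLocalStep`, `stub_ikLocalStepOut`) and the crux skeleton's `outwardSweepAt_of_IK` /
`inwardSweepAtUpTo_of_IK`. Discharging `_holds` is the Carleman machinery of the paper (XL).
-/

noncomputable section

namespace Literature.Geometry.Lorentzian

open Set
open scoped ContDiff

/-- **Ionescu–Klainerman 2013, Theorem 1.2 with Lemmas 2.10–2.11 (chart form, `d = 4`,
Lorentzian): local extension of Killing fields across a strongly pseudo-convex hypersurface of a
Ricci-flat metric, with a neighbourhood size depending only on the smoothness constant `A`, the
pseudo-convexity constant `A₁` and the data radius `δ₀`.** For all `1 ≤ A ≤ A₁` and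
`0 < δ₀ ≤ 1` there is `δ₁ ∈ (0, δ₀]` such that: for every metric datum `G` on the unit ball
`B₁(p)` of `E4` with `ricAt G = 0`, `G p = η`, every `f` smooth on `B₁(p)` with
`Σ_{j=1}^{6} ‖Dʲ G‖ + Σ_{j=1}^{4} ‖Dʲ f‖ ≤ A` on `B₁(p)`, `f p = 0`, `‖Df(p)‖ ≥ A₁⁻¹` and
(quant6) at `p` with constant `A₁`, and every smooth solution `Z` of the coordinate Killing
equation of `G` on `B_{δ₀}(p) ∩ {f < 0}`, there is a smooth solution `Z'` on `B_{δ₁}(p)`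
agreeing with `Z` on `B_{δ₁}(p) ∩ {f < 0}`.
[cite: IonescuKlainerman2013, Thm 1.2, Lemma 2.10, Lemma 2.11] -/
def IonescuKlainermanLocalExtension : Prop :=
  ∀ (A A₁ δ₀ : ℝ), 1 ≤ A → A ≤ A₁ → 0 < δ₀ → δ₀ ≤ 1 → ∃ δ₁ : ℝ, 0 < δ₁ ∧ δ₁ ≤ δ₀ ∧
    ∀ (G : E4 → E4 →L[ℝ] E4 →L[ℝ] ℝ) (f : E4 → ℝ) (p : E4) (Z : E4 → E4),
      MetricCoord.IsMetricOn G (Metric.ball p 1) →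
      (∀ x ∈ Metric.ball p 1, MetricCoord.ricAt G x = 0) →
      G p = Minkowski.bilin →
      ContDiffOn ℝ ∞ f (Metric.ball p 1) →
      (∀ x ∈ Metric.ball p 1,
        (∑ j ∈ Finset.Icc 1 6, ‖iteratedFDeriv ℝ j G x‖) +
          (∑ j ∈ Finset.Icc 1 4, ‖iteratedFDeriv ℝ j f x‖) ≤ A) →
      f p = 0 → A₁⁻¹ ≤ ‖fderiv ℝ f p‖ →
      (∃ μ ∈ Icc (-A₁) A₁, ∀ X : E4,
        A₁⁻¹ * ‖X‖ ^ 2 ≤ μ * G p X X - MetricCoord.hessAt G f p X X + A₁ * (fderiv ℝ f p X) ^ 2) →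
      ContDiffOn ℝ ∞ Z (Metric.ball p δ₀ ∩ {x | f x < 0}) →
      (∀ x ∈ Metric.ball p δ₀ ∩ {x | f x < 0}, ∀ Y W : E4,
        fderiv ℝ G x (Z x) Y W + G x (fderiv ℝ Z x Y) W + G x Y (fderiv ℝ Z x W) = 0) →
      ∃ Z' : E4 → E4, ContDiffOn ℝ ∞ Z' (Metric.ball p δ₁) ∧
        (∀ x ∈ Metric.ball p δ₁, ∀ Y W : E4,
          fderiv ℝ G x (Z' x) Y W + G x (fderiv ℝ Z' x Y) W + G x Y (fderiv ℝ Z' x W) = 0) ∧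
        EqOn Z' Z (Metric.ball p δ₁ ∩ {x | f x < 0})

/-! ### The `T`-conditional version (Ionescu–Klainerman 2015, Theorem 2.4)

A. D. Ionescu, S. Klainerman, *Rigidity results in general relativity: a review*, Surveys in
Differential Geometry 20 (2015) 123–156 (arXiv:1501.01587), **Theorem 2.4** with
**Definition 2.2** (strict `T`-null-convexity: the defining function `h` is `T`-invariant and
`D²h(X, X)(p) < 0` for the null vectors `X` tangent to the level set and ORTHOGONAL to `T`) and
its quantitative form **Lemma 2.17** (`|dh| ≥ M⁻¹`,
`YᵅYᵝ(μ g_{αβ} − D_αD_βh) + M(|Y(h)|² + |g(T, Y)|²) ≥ M⁻¹|Y|²`): if the Ricci-flat `(M, g)`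
admits a nowhere-vanishing Killing field `T` and `Z` is a Killing field in `O` commuting with
`T`, then `Z` extends as a Killing field past every boundary point of `O` at which `O` is
strictly `T`-null-convex, "and the extended `Z` continues to commute with `T`"; the proof is
that of the unconditional theorem (JAMS 26 (2013) Thm 1.2, whose neighbourhood depends only on
`A`, `A₁`, `δ₀`, remark after Thm 1.2) with the `T`-conditional Carleman weights of Invent.
Math. 175 (2009), §3, as carried out for the Hawking field of a stationary near-Kerr black hole
by Alexakis–Ionescu–Klainerman, CMP 299 (2010), §§5–6.

Rendering: the hypothesis list of `IonescuKlainermanLocalExtension` in coordinates ADAPTED to the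
conditioning field — `T = τ` a CONSTANT vector (flow-box coordinates of a nowhere-vanishing
field; then "`T` is Killing" is `∂_τ G = 0`, "`h` is `T`-invariant" is `∂_τ f = 0`, and
"`[T, Z] = 0`" is `∂_τ Z = 0`), with `A₁⁻¹ ≤ ‖τ‖ ≤ A₁`, the multiplier form of Lemma 2.17 at
`p` with the extra penalty `A₁ (G_p(τ, X))²`, and the commutation of the extension in the
conclusion.
-- TODO(general form): a general nowhere-vanishing Killing field `T`; all dimensions and signatures.

Consumed (as a hypothesis, by δ-unfolding) by the crux line `photon-shell-pseudoconvexity` of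
`GapExhaustion` (route `BartnikGapSettling`), the `T`-conditional extension of the Hawking field
in a stationary chart: `Summits/…/BartnikGapSettlingGapExhaustionIKLocalStepTOfConstants.lean`
(`ikLocalStepT_of_constants`), `…IKLocalStepTUniform.lean` (`stub_ikLocalStepTU`) and the crux
skeleton's `conditionalExtensionKStationary_of_IKC`. Discharging `_holds` is the Carleman
machinery of the papers (XL). -/

/-- **Ionescu–Klainerman 2015, Theorem 2.4 with Definition 2.2 and Lemma 2.17 (chart form,
`d = 4`, Lorentzian, coordinates adapted to the conditioning Killing field): `T`-CONDITIONAL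
local extension of Killing fields commuting with `T` across a strictly `T`-null-convex
hypersurface of a Ricci-flat metric, with a neighbourhood size depending only on `A`, `A₁`,
`δ₀`.** For all `1 ≤ A ≤ A₁` and `0 < δ₀ ≤ 1` there is `δ₁ ∈ (0, δ₀]` such that: for every
metric datum `G` on the unit ball `B₁(p)` of `E4` with `ricAt G = 0`, `G p = η`, every `f`
smooth on `B₁(p)` with `Σ_{j=1}^{6} ‖Dʲ G‖ + Σ_{j=1}^{4} ‖Dʲ f‖ ≤ A` on `B₁(p)`, `f p = 0`,
`‖Df(p)‖ ≥ A₁⁻¹`, every constant vector `τ` with `A₁⁻¹ ≤ ‖τ‖ ≤ A₁` which is a Killing field of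
`G` (`∂_τ G = 0` on `B₁(p)`) leaving `f` invariant (`∂_τ f = 0`), the quantitative
`T`-null-convexity at `p`
(`A₁⁻¹‖X‖² ≤ μ G_p(X,X) − D²f_p(X,X) + A₁((Df_p X)² + (G_p(τ, X))²)`, `μ ∈ [−A₁, A₁]`), and
every smooth solution `Z` of the coordinate Killing equation of `G` on `B_{δ₀}(p) ∩ {f < 0}`
with `∂_τ Z = 0` there, there is a smooth solution `Z'` on `B_{δ₁}(p)` with `∂_τ Z' = 0`,
agreeing with `Z` on `B_{δ₁}(p) ∩ {f < 0}`.
[cite: IonescuKlainerman2015, Thm 2.4, Def. 2.2, Lemma 2.17] -/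
def IonescuKlainermanConditionalLocalExtension : Prop :=
  ∀ (A A₁ δ₀ : ℝ), 1 ≤ A → A ≤ A₁ → 0 < δ₀ → δ₀ ≤ 1 → ∃ δ₁ : ℝ, 0 < δ₁ ∧ δ₁ ≤ δ₀ ∧
    ∀ (G : E4 → E4 →L[ℝ] E4 →L[ℝ] ℝ) (f : E4 → ℝ) (p τ : E4) (Z : E4 → E4),
      MetricCoord.IsMetricOn G (Metric.ball p 1) →
      (∀ x ∈ Metric.ball p 1, MetricCoord.ricAt G x = 0) →
      G p = Minkowski.bilin →
      ContDiffOn ℝ ∞ f (Metric.ball p 1) →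
      (∀ x ∈ Metric.ball p 1,
        (∑ j ∈ Finset.Icc 1 6, ‖iteratedFDeriv ℝ j G x‖) +
          (∑ j ∈ Finset.Icc 1 4, ‖iteratedFDeriv ℝ j f x‖) ≤ A) →
      f p = 0 → A₁⁻¹ ≤ ‖fderiv ℝ f p‖ →
      A₁⁻¹ ≤ ‖τ‖ → ‖τ‖ ≤ A₁ →
      (∀ x ∈ Metric.ball p 1, fderiv ℝ G x τ = 0) →
      (∀ x ∈ Metric.ball p 1, fderiv ℝ f x τ = 0) →
      (∃ μ ∈ Icc (-A₁) A₁, ∀ X : E4,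
        A₁⁻¹ * ‖X‖ ^ 2 ≤ μ * G p X X - MetricCoord.hessAt G f p X X +
          A₁ * ((fderiv ℝ f p X) ^ 2 + (G p τ X) ^ 2)) →
      ContDiffOn ℝ ∞ Z (Metric.ball p δ₀ ∩ {x | f x < 0}) →
      (∀ x ∈ Metric.ball p δ₀ ∩ {x | f x < 0}, ∀ Y W : E4,
        fderiv ℝ G x (Z x) Y W + G x (fderiv ℝ Z x Y) W + G x Y (fderiv ℝ Z x W) = 0) →
      (∀ x ∈ Metric.ball p δ₀ ∩ {x | f x < 0}, fderiv ℝ Z x τ = 0) →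
      ∃ Z' : E4 → E4, ContDiffOn ℝ ∞ Z' (Metric.ball p δ₁) ∧
        (∀ x ∈ Metric.ball p δ₁, ∀ Y W : E4,
          fderiv ℝ G x (Z' x) Y W + G x (fderiv ℝ Z' x Y) W + G x Y (fderiv ℝ Z' x W) = 0) ∧
        (∀ x ∈ Metric.ball p δ₁, fderiv ℝ Z' x τ = 0) ∧
        EqOn Z' Z (Metric.ball p δ₁ ∩ {x | f x < 0})

end Literature.Geometry.Lorentzian

end
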